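import Literature.AlgebraicGeometry.Surfaces.K3SurfaceProofs
import Literature.AlgebraicGeometry.HodgeTheory.GysinBaseChange
import HarnessLib

/-!
# Buskin's Theorem 1.1 modulo Prop. 6.2 and the multiplicativity of algebraic classes:
# the composition of algebraic correspondences between K3 surfaces (Lemma 6.3) discharged

Family `hodge`, layer `Literature/AlgebraicGeometry/Surfaces`. N. Buskin, *Every rational Hodge
isometry between two K3 surfaces is algebraic*, J. reine angew. Math. 755 (2019), §6.2: the proof
of Thm. 1.1 assembles Prop. 6.2 (reflective / cyclic-characteristic isometries are algebraic) with
Lemma 6.3 ("Let `α ∈ H^*(S₁ × S₂, ℚ)` and `β ∈ H^*(S₂ × S₃, ℚ)` be algebraic classes … Then the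
class `π₁₃_*(π₁₂^*(α) ∪ π₂₃^*(β))` is also algebraic"). The tree's
`Buskin2019_hodgeIsometry_algebraic_of_reflective_at` (`K3SurfaceProofs`) derives the named fact
`Buskin2019_hodgeIsometry_algebraic` from the period facts, Prop. 6.2 at one orientation family
(`hrefl₀`) and Lemma 6.3 at that family (`hcomp₀`). Lemma 6.3 is now the tree's theorem
`HodgeTheory.corrComp_surfaces_of_cup` (`HodgeTheory/GysinBaseChange`: Fulton §16.1 composition
`corr_comp_of_baseChange` with the PROVED Gysin base change `gysin_baseChange` — from the Künneth
formula `LerayHirsch.kunneth_mem_span_of_field`, `AlgebraicTopology/SingularHomology/KunnethFormula` — and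
`corrCompClass_mem_algebraicClasses`), GRANTED only the multiplicativity `N² ∪ N² ⊆ N⁴` of
algebraic classes on triple products of surfaces (`hCUP`; Voisin II Prop. 9.20, the moving-lemma
input, a hypothesis in the tree by design, cf. `HodgeTheory/AlgebraicClassesCup`). Hence:

* `corrComp_K3_of_cup` — the hypothesis `hcomp₀` of `Buskin2019_hodgeIsometry_algebraic_of_reflective_at`
  (composition of algebraic correspondences between K3 surfaces, at any orientation family), from
  `hCUP`;
* `Buskin2019_hodgeIsometry_algebraic_of_reflective_of_cup` — **Buskin's Thm. 1.1** (the named fact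
  `Buskin2019_hodgeIsometry_algebraic`) **from** `Huybrechts_K3_periodSurjective_projective`,
  `Huybrechts_K3_marking_exists` (named facts), **Prop. 6.2 at one orientation family** (`hrefl₀`)
  **and `hCUP`**.

Conditional (on the two named facts and the inline hypotheses `hrefl₀`, `hCUP`); the composition
step itself is unconditional given `hCUP`. This is the consumer announced in
`HodgeTheory/CorrespondenceComposition` ("Consumer: `Surfaces/K3CorrespondenceComposition`").

## References

* [Buskin2019] N. Buskin, Every rational Hodge isometry between two K3 surfaces is algebraic,
  J. reine angew. Math. 755 (2019), Thm. 1.1, §6.2 Prop. 6.2, Lemma 6.3.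
* [Huybrechts2019] D. Huybrechts, Motives of isogenous K3 surfaces, Comment. Math. Helv. 94 (2019), §1.1.
* [VoisinHodgeII2003] C. Voisin, Hodge Theory and Complex Algebraic Geometry II, CUP 2003, §9.2.4 Prop. 9.20.
* [Fulton1998] W. Fulton, Intersection Theory, 2nd ed., Springer 1998, §16.1.
-/

noncomputable section

open CategoryTheory MonoidalCategory
open Literature.AlgebraicTopology.SingularHomology
open Literature.LinearAlgebra.QuadraticForm

namespace Literature.AlgebraicGeometry.Surfaces

section CompositionOfCup

/-- `MarkedK3[S, η, p, x]` (as in `K3SurfaceProofs`): a marked K3 surface with period `x`.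
Local notation only. -/
local notation3 (prettyPrint := false) "MarkedK3[" S ", " η ", " p ", " x "]" =>
  (HodgeTheory.IsIntegralClass p ∧
    (∀ q : HodgeTheory.complexBetti S (2 * 2), HodgeTheory.IsIntegralClass q → ∃ n : ℤ, q = n • p) ∧
    (∀ c : HodgeTheory.complexBetti S (2 * 1),
        HodgeTheory.IsIntegralClass c ↔ ∃ v : K3Index → ℤ, η c = fun i => (v i : ℂ)) ∧
    (∀ a b : HodgeTheory.complexBetti S (2 * 1),
        cupProduct (rfl : 2 * 1 + 2 * 1 = 2 * 2) a b = k3Form (η a) (η b) • p) ∧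
    HodgeTheory.IsOfHodgeType 2 S (2 * 1) 2 0 (LinearEquiv.symm η x) ∧
    (∀ τ : HodgeTheory.complexBetti S (2 * 1),
        HodgeTheory.IsOfHodgeType 2 S (2 * 1) 2 0 τ → ∃ t : ℂ, τ = t • LinearEquiv.symm η x))

/-- `PeriodPt[x]` (as in `K3SurfaceProofs`): a projective period point. Local notation only. -/
local notation3 (prettyPrint := false) "PeriodPt[" x "]" =>
  (k3Form x x = 0 ∧ 0 < (k3Form (star x) x).re ∧
    ∃ u : K3Index → ℤ, k3Form (fun i => (u i : ℂ)) x = 0 ∧ 0 < ∑ i, ∑ j, u i * k3Gram i j * u j)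

/-- `Corr[μ, S, S', hS, hS' ; γ, y] = [γ]_* y = fst_* (snd^* y ∪ γ)` (as in `K3SurfaceProofs`):
LITERALLY the expression in the conclusion of `Buskin2019_hodgeIsometry_algebraic`. Local notation
only. -/
local notation3 (prettyPrint := false) "Corr[" μ ", " S ", " S' ", " hS ", " hS' " ; " γ ", " y "]" =>
  HodgeTheory.complexGysin μ
    (Motives.IsSmoothProjective.tensor_holds (IsK3Surface.isSmoothProjective hS)
      (IsK3Surface.isSmoothProjective hS'))
    (IsK3Surface.isSmoothProjective hS) (SemiCartesianMonoidalCategory.fst S S')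
    (rfl : 2 * 1 + 2 * 2 + 2 * 2 = 2 * 1 + 2 * (2 + 2))
    (cupProduct (rfl : 2 * 1 + 2 * 2 = 2 * 1 + 2 * 2)
      (HodgeTheory.complexBetti.map (SemiCartesianMonoidalCategory.snd S S') (2 * 1) y) γ)

/-- **Composition of algebraic correspondences between K3 surfaces (Buskin, Lemma 6.3), at any
orientation family, from the multiplicativity of algebraic classes**: the hypothesis `hcomp₀` of
`Buskin2019_hodgeIsometry_algebraic_of_reflective_at`, by specialising the tree's
`HodgeTheory.corrComp_surfaces_of_cup` (smooth projective surfaces; Gysin base change proved) to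
K3 surfaces. [cite: Buskin2019, Lemma 6.3] [cite: Fulton1998, §16.1 Def. 16.1.1 and Prop. 16.1.1]
[cite: VoisinHodgeII2003, §9.2.4 Prop. 9.20] -/
theorem corrComp_K3_of_cup (μ₀ : HodgeTheory.OrientationFamily)
    (hCUP : ∀ (A B C : Motives.SchemeOver ℂ), Motives.IsSmoothProjective 2 A →
      Motives.IsSmoothProjective 2 B → Motives.IsSmoothProjective 2 C →
      ∀ a ∈ HodgeTheory.algebraicClasses (A ⊗ (B ⊗ C)) 2,
      ∀ b ∈ HodgeTheory.algebraicClasses (A ⊗ (B ⊗ C)) 2,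
        cupProduct ((Nat.mul_add 2 2 2).symm : 2 * 2 + 2 * 2 = 2 * (2 + 2)) a b ∈
          HodgeTheory.algebraicClasses (A ⊗ (B ⊗ C)) (2 + 2))
    (S S' S'' : Motives.SchemeOver ℂ) (hS : IsK3Surface S) (hS' : IsK3Surface S')
    (hS'' : IsK3Surface S'') :
    ∀ γ ∈ HodgeTheory.algebraicClasses (MonoidalCategoryStruct.tensorObj S S') 2,
    ∀ γ' ∈ HodgeTheory.algebraicClasses (MonoidalCategoryStruct.tensorObj S' S'') 2,
    ∃ γ'' ∈ HodgeTheory.algebraicClasses (MonoidalCategoryStruct.tensorObj S S'') 2,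
      ∀ y : HodgeTheory.complexBetti S'' (2 * 1),
        Corr[μ₀, S, S'', hS, hS'' ; γ'', y] =
          Corr[μ₀, S, S', hS, hS' ; γ, Corr[μ₀, S', S'', hS', hS'' ; γ', y]] :=
  fun γ hγ γ' hγ' ↦ HodgeTheory.corrComp_surfaces_of_cup μ₀ hCUP S S' S'' hS.1 hS'.1 hS''.1 γ hγ γ' hγ'

/-- **Buskin's Theorem 1.1 from the period facts, Prop. 6.2 at one orientation family, and the
multiplicativity of algebraic classes** (§6.2, proof of Thm. 1.1: every rational Hodge isometry
between projective K3 surfaces is a composite of reflective ones, each algebraic by Prop. 6.2,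
composed by Lemma 6.3): the named fact `Buskin2019_hodgeIsometry_algebraic` follows from
`Huybrechts_K3_periodSurjective_projective`, `Huybrechts_K3_marking_exists`, Prop. 6.2 at `μ₀`
(`hrefl₀`) and `N² ∪ N² ⊆ N⁴` on triple products of surfaces (`hCUP`) — Lemma 6.3 (`hcomp₀` of
`Buskin2019_hodgeIsometry_algebraic_of_reflective_at`) being the theorem `corrComp_K3_of_cup`.
Poincaré duality for `μ₀` is the tree's theorem `OrientationFamily.hasPoincareDuality`.
[cite: Buskin2019, Thm. 1.1 and §6.2 (proof of Thm. 1.1, Prop. 6.2, Lemma 6.3)] [cite: Huybrechts2019, §1.1]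
[cite: VoisinHodgeII2003, §9.2.4 Prop. 9.20] -/
theorem Buskin2019_hodgeIsometry_algebraic_of_reflective_of_cup (μ₀ : HodgeTheory.OrientationFamily)
    (h : Huybrechts_K3_periodSurjective_projective) (hM : Huybrechts_K3_marking_exists)
    (hrefl₀ : ∀ (S S' : Motives.SchemeOver ℂ) (hS : IsK3Surface S) (hS' : IsK3Surface S')
      (η : HodgeTheory.complexBetti S (2 * 1) ≃ₗ[ℂ] (K3Index → ℂ))
      (p : HodgeTheory.complexBetti S (2 * 2)) (x : K3Index → ℂ)
      (η' : HodgeTheory.complexBetti S' (2 * 1) ≃ₗ[ℂ] (K3Index → ℂ))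
      (p' : HodgeTheory.complexBetti S' (2 * 2)) (x' : K3Index → ℂ),
      MarkedK3[S, η, p, x] → PeriodPt[x] → MarkedK3[S', η', p', x'] → PeriodPt[x'] →
      ∀ v : K3Index → ℤ, ∑ i, ∑ j, v i * k3Gram i j * v j ≠ 0 →
      (∃ t : ℂ, k3ReflectionC v x' = t • x) →
      ∃ γ ∈ HodgeTheory.algebraicClasses (MonoidalCategoryStruct.tensorObj S S') 2,
        ∀ y : HodgeTheory.complexBetti S' (2 * 1),
          η.symm (k3ReflectionC v (η' y)) = Corr[μ₀, S, S', hS, hS' ; γ, y])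
    (hCUP : ∀ (A B C : Motives.SchemeOver ℂ), Motives.IsSmoothProjective 2 A →
      Motives.IsSmoothProjective 2 B → Motives.IsSmoothProjective 2 C →
      ∀ a ∈ HodgeTheory.algebraicClasses (A ⊗ (B ⊗ C)) 2,
      ∀ b ∈ HodgeTheory.algebraicClasses (A ⊗ (B ⊗ C)) 2,
        cupProduct ((Nat.mul_add 2 2 2).symm : 2 * 2 + 2 * 2 = 2 * (2 + 2)) a b ∈
          HodgeTheory.algebraicClasses (A ⊗ (B ⊗ C)) (2 + 2)) :
    Buskin2019_hodgeIsometry_algebraic :=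
  Buskin2019_hodgeIsometry_algebraic_of_reflective_at μ₀ (HodgeTheory.OrientationFamily.hasPoincareDuality μ₀)
    h hM hrefl₀ (corrComp_K3_of_cup μ₀ hCUP)

end CompositionOfCup

end Literature.AlgebraicGeometry.Surfaces

end
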